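import Summits.BirchSwinnertonDyer.BirchSwinnertonDyer.Theorems.KolyvaginDepthDoorDepthTableKuriharaDecisivePrime
import Summits.BirchSwinnertonDyer.BirchSwinnertonDyer.Theorems.KolyvaginDepthDoorDepthTableKuriharaDecisive563a1
import Summits.BirchSwinnertonDyer.Rank1Residual.Supersingular.CountPointsFast
import HarnessLib

/-!
# Route `KolyvaginDepthDoor`, crux `KolyvaginDepthSupplyKN` (stmt-BirchSwinnertonDyer-22820) —
# DEPTH TABLE v19, ROW `563a1` @ `(7, d_K = -8)`: A SECOND DECISIVE PRIME `ℓ★₂ = 659` AND THE AGREEMENT TEST `δ̃_281 unit ⟺ δ̃_659 unit` — the row's bit ⟺ a unit mod-`7`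
# Kurihara number of the twist model `T₀ = [0, -1, 0, -961, -11167]` AT THE ONE PRIME `659` (kernel: `92 • P̄ ≠ O` in `T̃₀(𝔽_659)` for
# `P = (2368/49, 78905/343)`, `#T̃₀(𝔽_659) = 644 = 7·92`)

Helper file of the lead prover of line `levelone` (kdd-p1 g23; `--supports stmt-BirchSwinnertonDyer-22820
--as helper`); it closes nothing and BSD is NOT proved by it. Sequel of `…KuriharaDecisive563a1` (first decisive prime `281`): a SECOND decisive prime `659` by the same template, and the AGREEMENT COROLLARY `unit_281_iff_unit_659` — modulo print the two residues `δ̃_281(T₀)`, `δ̃_659(T₀)` are BOTH units or BOTH zero (each is ⟺ the row's bit): an internal consistency test of the fleet's modular-symbol engine at level `N_{T₀}`, falsifiable by two residues.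

v18 (g22, `…KuriharaSocket563a1`) read the row EXACTLY as «bit ⟺ SOME cyclic Kolyvagin prime `ℓ` of `(T₀, 7)` carries
a unit `δ̃_ℓ(T₀)`», and CLOSING-DATA-v18 §2b marked `ℓ = 659` with ★ (the known point `P = (2368/49, 78905/343)` of `T₀` is not
divisible by `7` in `T̃₀(𝔽_659)` — a heuristic there). v19 makes the ★ a THEOREM-LEVEL statement: by the generic
`…KuriharaDecisivePrime` (Sakamoto 2022 Lemma 4.4 + Lemma 4.6 (1) BY NAME, `hSak3`), the bit — which gives `#Sel_7(E^{(-8)}) ≤ 7`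
by the row's exact reading — FORCES `δ̃_659(T₀) ≢ 0 (mod 7)`, the local `7`-indivisibility of `P` at `659` being
KERNEL-CHECKED here (`minTwist8_localNondivisible_659`: an affine double-and-add chain of 9 certified steps reaching
`92 • P̄ = (185, 326) ≠ O` in `T̃₀(𝔽_659)` by `decide`, `7·92 = #T̃₀(𝔽_659) = 644`, and the bridge `localNondivisible_of_chainB`).
Conversely a unit at `659` closes the row by the socket. HENCE

* `twistKuriharaBit_iff_unit_659` — **bit ⟺ unit `δ̃_659(T₀)`** (for every admissible datum of `T₀`): the fleet's ONE
  residue `δ̃_659(T₀) mod 7` DECIDES the row `563a1` @ `(7, -8)` BOTH WAYS modulo print — a computed ZERO refutes the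
  crux's clause at `(7, ℚ(√-8))` for `563a1` (the row then moves to another admissible prime / Heegner field), a UNIT proves it.

Kernel lemmas: `minTwist8_card_659` (`#T̃₀(𝔽_659) = 644`, `a_659(T₀) = 16 ≡ 2 (mod 7)`), `minTwist8_isCyclicKolyvaginLevel_7_659`,
`minTwist8_localNondivisible_659`. CONDITIONAL on the named facts displayed and the E-side record claim `hδE`; per curve; nothing
class-wide; BSD is NOT proved by any of this.

References: [Sakamoto2022pSelmer] Lemma 4.4, Lemma 4.6 (1), Thm. 1.2, Thm. 1.5; [Kim2022StructureSelmer] Thm. 1.11;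
[Kurihara2014] §5.3; [SilvermanAEC2009] III.2.3, VII.2.1, VII.3.1; [CremonaAlgorithms1997] Table 1 (563a1).
-/

set_option linter.dupNamespace false

noncomputable section

open scoped Classical NumberField

namespace Summit.BirchSwinnertonDyer.BirchSwinnertonDyer.Theorems.KolyvaginDepthDoor

open Literature.NumberTheory.EllipticCurves Literature.NumberTheory.EllipticCurves.ModularForms
  WeierstrassCurve NumberField IsDedekindDomain
open Summit.BirchSwinnertonDyer.BirchSwinnertonDyer.Theorems
open Summit.BirchSwinnertonDyer.BirchSwinnertonDyer.Rank2Observatory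
open Summit.BirchSwinnertonDyer.BirchSwinnertonDyer.Rank1Residual (IntModel.frobeniusTrace_eq)
open Summit.BirchSwinnertonDyer.Rank1Residual.Supersingular (natCard_point_eq_of_countPoints countPoints_eq_of_fast)
open Summit.BirchSwinnertonDyer.Rank1Residual.Additive (card_torsion_le_of_intModel_of_card
  isKolyvaginPrime_of_intModel_of_card)

namespace C563a1

/-- `#T̃₀(𝔽_659) = 644 = 7·92` for `T₀ = [0, -1, 0, -961, -11167]` (`659 ≡ 1 (mod 7)`, `a_659(T₀) = 16 ≡ 2 (mod 7)`, `7² ∤ 644`),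
kernel-decided (`countPointsFast`). [cite: Kim2022StructureSelmer, §1.2.2 (PDF p. 5)] -/
theorem minTwist8_card_659 :
    Nat.card (((⟨0, -1, 0, -961, -11167⟩ : WeierstrassCurve ℤ).map (Int.castRingHom (ZMod 659))).toAffine.Point) = 644 :=
  haveI : Fact (Nat.Prime 659) := ⟨by norm_num⟩
  natCard_point_eq_of_countPoints 0 (-1) 0 (-961) (-11167) 659 (by norm_num) (by decide +kernel) (n := 644)
    (countPoints_eq_of_fast (by decide +kernel))

/-- **`659` is a CYCLIC KOLYVAGIN PRIME for `(T₀, 7)`** (`659 ∤ 7·N_{T₀}`, `659 ≡ 1`, `a_659(T₀) ≡ 2 (mod 7)`,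
`#T̃₀(𝔽_659)[7] ≤ 7`) — a ★ candidate of CLOSING-DATA-v18 §2b. [cite: Kim2022StructureSelmer, §1.2.2 (PDF p. 5)] -/
theorem minTwist8_isCyclicKolyvaginLevel_7_659 :
    haveI := minTwist8_isGloballyMinimal; haveI := Fact.mk (by norm_num : Nat.Prime 7);
    IsCyclicKolyvaginLevel ((⟨0, -1, 0, -961, -11167⟩ : WeierstrassCurve ℤ).map (Int.castRingHom ℚ)) 7 659 := by
  haveI := minTwist8_isElliptic
  haveI := minTwist8_isGloballyMinimal
  haveI := Fact.mk (by norm_num : Nat.Prime 7)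
  haveI : Fact (Nat.Prime 659) := ⟨by norm_num⟩
  have hℓ : Kato.IsKolyvaginPrime ((⟨0, -1, 0, -961, -11167⟩ : WeierstrassCurve ℤ).map (Int.castRingHom ℚ)) 7 1 659 :=
    isKolyvaginPrime_of_intModel_of_card minTwist8_intModel 7 1 659 (by norm_num) (by decide +kernel) (by decide)
      minTwist8_card_659 (by norm_num)
  refine ⟨⟨Nat.squarefree_iff_nodup_primeFactorsList (by norm_num) |>.mpr (by simp), fun ℓ hℓ' ↦ ?_⟩, fun ℓ hℓ' hdvd ↦ ?_⟩
  · rw [show (659 : ℕ).primeFactors = {659} from (Nat.Prime.primeFactors (by norm_num)), Finset.mem_singleton] at hℓ'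
    exact hℓ' ▸ hℓ
  · obtain rfl := (Nat.prime_dvd_prime_iff_eq hℓ'.out (by norm_num)).mp hdvd
    exact card_torsion_le_of_intModel_of_card minTwist8_intModel 7 659 minTwist8_card_659 (by norm_num)

/-- The double-and-add chain from `P̄` reaches the multiplier `92`. [folklore] -/
theorem chain659_mult :
    chainMult 1 [(true, ((120 : ℤ) : ZMod 659), ((629 : ℤ) : ZMod 659)), (true, ((2 : ℤ) : ZMod 659), ((444 : ℤ) : ZMod 659)), (false, ((318 : ℤ) : ZMod 659), ((38 : ℤ) : ZMod 659)), (true, ((14 : ℤ) : ZMod 659), ((433 : ℤ) : ZMod 659)), (false, ((604 : ℤ) : ZMod 659), ((577 : ℤ) : ZMod 659)), (true, ((435 : ℤ) : ZMod 659), ((335 : ℤ) : ZMod 659)), (false, ((101 : ℤ) : ZMod 659), ((114 : ℤ) : ZMod 659)), (true, ((491 : ℤ) : ZMod 659), ((63 : ℤ) : ZMod 659)), (true, ((185 : ℤ) : ZMod 659), ((326 : ℤ) : ZMod 659))] = 92 := by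
  decide

/-- The double-and-add chain from `P̄ = (398, 524)` to `92 • P̄ = (185, 326)` in `T̃₀(𝔽_659)` CHECKS (tangent / chord
certificates, `decide`). [cite: SilvermanAEC2009, III.2.3] -/
theorem chain659_ok :
    chainB (⟨0, -1, 0, -961, -11167⟩ : WeierstrassCurve ℤ) 659 (((398 : ℤ)) : ZMod 659) (((524 : ℤ)) : ZMod 659)
      ((((398 : ℤ)) : ZMod 659), (((524 : ℤ)) : ZMod 659))
      [(true, ((120 : ℤ) : ZMod 659), ((629 : ℤ) : ZMod 659)), (true, ((2 : ℤ) : ZMod 659), ((444 : ℤ) : ZMod 659)), (false, ((318 : ℤ) : ZMod 659), ((38 : ℤ) : ZMod 659)), (true, ((14 : ℤ) : ZMod 659), ((433 : ℤ) : ZMod 659)), (false, ((604 : ℤ) : ZMod 659), ((577 : ℤ) : ZMod 659)), (true, ((435 : ℤ) : ZMod 659), ((335 : ℤ) : ZMod 659)), (false, ((101 : ℤ) : ZMod 659), ((114 : ℤ) : ZMod 659)), (true, ((491 : ℤ) : ZMod 659), ((63 : ℤ) : ZMod 659)), (true, ((185 : ℤ) : ZMod 659), ((326 : ℤ) : ZMod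 659))] = true := by
  decide +kernel

/-- **KERNEL: `P = (2368/49, 78905/343)` is not divisible by `7` in `T₀(ℚ_659)`** — the chain certifies `92 • P̄ ≠ O` in `T̃₀(𝔽_659)`,
`7·92 = #T̃₀(𝔽_659)`, and `localNondivisible_of_chainB`. This is the ★ of CLOSING-DATA-v18 §2b for `563a1` at `659`, now in
the kernel. [cite: SilvermanAEC2009, III.2.3, VII.2 Prop. 2.1, VII.3 Prop. 3.1] -/
theorem minTwist8_localNondivisible_659 :
    haveI : Fact (Nat.Prime 659) := ⟨by norm_num⟩;
    ∀ Q : (((⟨0, -1, 0, -961, -11167⟩ : WeierstrassCurve ℤ).map (Int.castRingHom ℚ)).baseChange ℚ_[659]).toAffine.Point,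
      7 • Q ≠ WeierstrassCurve.Affine.Point.map (W' := ((⟨0, -1, 0, -961, -11167⟩ : WeierstrassCurve ℤ).map (Int.castRingHom ℚ)).toAffine)
        (S := ℚ) (Algebra.ofId ℚ ℚ_[659]) (.some ((2368 : ℚ) / 49) ((78905 : ℚ) / 343) minTwist8_nonsingular_P) := by
  haveI : Fact (Nat.Prime 659) := ⟨by norm_num⟩
  have hq : ¬ ((659 : ℕ) : ℤ) ∣ (⟨0, -1, 0, -961, -11167⟩ : WeierstrassCurve ℤ).Δ := by decide +kernel
  have hx : ¬ (659 : ℕ) ∣ (((2368 : ℚ) / 49)).den := by decide +kernel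
  have hy : ¬ (659 : ℕ) ∣ (((78905 : ℚ) / 343)).den := by decide +kernel
  have hm : ((659 : ℕ) : ℤ) ∣ (((2368 : ℚ) / 49)).num - (398 : ℤ) * (((2368 : ℚ) / 49)).den := by decide +kernel
  have hm' : ((659 : ℕ) : ℤ) ∣ (((78905 : ℚ) / 343)).num - (524 : ℤ) * (((78905 : ℚ) / 343)).den := by decide +kernel
  have hpk : 7 * 92 = Nat.card (((⟨0, -1, 0, -961, -11167⟩ : WeierstrassCurve ℤ).map (Int.castRingHom (ZMod 659))).toAffine.Point) := by
    rw [minTwist8_card_659]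
  exact localNondivisible_of_chainB_rat (⟨0, -1, 0, -961, -11167⟩ : WeierstrassCurve ℤ) 659 hq minTwist8_nonsingular_P hx hy hm hm' hpk
    chain659_mult (by convert chain659_ok)

/-- **ROW `563a1` @ `(7, -8)`: THE DECISIVE PRIME `659` — bit ⟺ unit `δ̃_659(T₀)`.** For every imaginary quadratic `K`
with `d_K = -8`, granted the named facts displayed and the E-side record claim `hδE`: «some frame, some Kolyvagin PRIME
`ℓ`, some Kolyvagin–Heegner datum of conductor `ℓ` with `c_1(ℓ) ≠ 0`» (the depth-table bit) holds IF AND ONLY IF «every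
datum `D` of `T₀` at level `N_{T₀}` with `7 ∤ c_D` and the period transfer has a UNIT mod-`7` Kurihara number AT `659`» —
the claim of a future tree record `cert_<T₀>` @ `(7, 659)`. (⟹): bit ⟹ `#Sel_7(E^{(-8)}) ≤ 7` (the socket's exact reading
∘ v18's twist IFF) ⟹ unit at `659` (`twistKuriharaClaim_prime_of_natCard_selmerGroup_le` with the kernel certificate
`minTwist8_localNondivisible_659`); (⟸): the exact reading with `m = 659` (`minTwist8_isCyclicKolyvaginLevel_7_659`, `ν(659) = 1`).
CONDITIONAL on the named facts and the claim; per curve; BSD is not proved by it.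
[cite: Sakamoto2022pSelmer, Lemma 4.4, Lemma 4.6 (1), Thm. 1.2, Thm. 1.5] [cite: Kim2022StructureSelmer, Thm. 1.11]
[cite: CremonaAlgorithms1997, Table 1 (563a1)] -/
theorem twistKuriharaBit_iff_unit_659
    (h372 : GrossLMS1991.prop37_2_frobeniusCongruence)
    (h84 : Literature.NumberTheory.EllipticCurves.WZhang2014_lemma84_exists_minimal_kolyvaginClass_one_selmerCard)
    (hKim : Kim2022_card_selmerGroup_le_pow_of_kuriharaNumber_ne_zero)
    (hSak1 : Sakamoto2022_card_selmerGroup_eq_pow_of_isDeltaMinimal)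
    (hSak2 : Sakamoto2022_exists_cyclicLevel_kuriharaNumber_ne_zero)
    (hSak3 : Literature.NumberTheory.EllipticCurves.Sakamoto2022_kuriharaNumber_prime_ne_zero_of_localNondivisible)
    (hnf : exists_isNewformOf) (hMaz : mazur_not_dvd_maninConstant_of_odd)
    (K : Type) [Field K] [NumberField K] (hK : IsImaginaryQuadratic K) (hD : NumberField.discr K = -8)
    (hδE : haveI := isElliptic_c563a1; haveI := isGloballyMinimal_c563a1;
      haveI : NeZero (((⟨1, 1, 1, -15, 16⟩ : WeierstrassCurve ℤ).map (Int.castRingHom ℚ)).conductorNorm ℤ) := neZero_conductorNorm_of_isElliptic _;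
      haveI := Fact.mk (by norm_num : Nat.Prime 7);
      ∀ (D : ModularParametrizationData ((⟨1, 1, 1, -15, 16⟩ : WeierstrassCurve ℤ).map (Int.castRingHom ℚ)) (((⟨1, 1, 1, -15, 16⟩ : WeierstrassCurve ℤ).map (Int.castRingHom ℚ)).conductorNorm ℤ)), ¬ ((7 : ℕ) : ℤ) ∣ D.maninConstant →
        (∃ u : ℚ, ‖(u : ℚ_[7])‖ = 1 ∧ ((⟨1, 1, 1, -15, 16⟩ : WeierstrassCurve ℤ).map (Int.castRingHom ℚ)).realPeriodRat = u * plusPeriod D.f) →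
        ∃ ψ : (ℓ : ℕ) → (ZMod ℓ)ˣ →* Multiplicative (ZMod 7),
          (∀ ℓ ∈ (8149 : ℕ).primeFactors, Function.Surjective (ψ ℓ)) ∧ kuriharaNumber D.f 7 8149 ψ ≠ 0) :
    haveI := isElliptic_c563a1; haveI := isGloballyMinimal_c563a1;
    haveI : NeZero (((⟨1, 1, 1, -15, 16⟩ : WeierstrassCurve ℤ).map (Int.castRingHom ℚ)).conductorNorm ℤ) := neZero_conductorNorm_of_isElliptic _;
    haveI := minTwist8_isElliptic; haveI := minTwist8_isGloballyMinimal;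
    haveI : NeZero (((⟨0, -1, 0, -961, -11167⟩ : WeierstrassCurve ℤ).map (Int.castRingHom ℚ)).conductorNorm ℤ) := neZero_conductorNorm_of_isElliptic _;
    haveI := Fact.mk (by norm_num : Nat.Prime 7);
    (∃ (Dt : ModularParametrizationData ((⟨1, 1, 1, -15, 16⟩ : WeierstrassCurve ℤ).map (Int.castRingHom ℚ)) (((⟨1, 1, 1, -15, 16⟩ : WeierstrassCurve ℤ).map (Int.castRingHom ℚ)).conductorNorm ℤ)) (β : ℤ)
      (ι : K →+* ℂ) (ℓ : ℕ) (d : KolyvaginHeegnerData Dt β ι ℓ),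
      ℓ.Prime ∧ Zhang2014.IsKolyvaginPrime (((⟨1, 1, 1, -15, 16⟩ : WeierstrassCurve ℤ).map (Int.castRingHom ℚ)).conductorNorm ℤ) ((⟨1, 1, 1, -15, 16⟩ : WeierstrassCurve ℤ).map (Int.castRingHom ℚ)) K 7 ℓ ∧
        d.kolyvaginClass (p := 7) (by norm_num) 1 ≠ 0) ↔
    (∀ (D : ModularParametrizationData ((⟨0, -1, 0, -961, -11167⟩ : WeierstrassCurve ℤ).map (Int.castRingHom ℚ))
          (((⟨0, -1, 0, -961, -11167⟩ : WeierstrassCurve ℤ).map (Int.castRingHom ℚ)).conductorNorm ℤ)),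
        ¬ ((7 : ℕ) : ℤ) ∣ D.maninConstant →
        (∃ u : ℚ, ‖(u : ℚ_[7])‖ = 1 ∧
          ((⟨0, -1, 0, -961, -11167⟩ : WeierstrassCurve ℤ).map (Int.castRingHom ℚ)).realPeriodRat = u * plusPeriod D.f) →
        ∃ ψ : (q : ℕ) → (ZMod q)ˣ →* Multiplicative (ZMod 7),
          (∀ q ∈ (659 : ℕ).primeFactors, Function.Surjective (ψ q)) ∧ kuriharaNumber D.f 7 659 ψ ≠ 0) := by
  haveI := isElliptic_c563a1
  haveI := isGloballyMinimal_c563a1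
  haveI iNZ : NeZero (((⟨1, 1, 1, -15, 16⟩ : WeierstrassCurve ℤ).map (Int.castRingHom ℚ)).conductorNorm ℤ) :=
    neZero_conductorNorm_of_isElliptic _
  haveI := minTwist8_isElliptic
  haveI := minTwist8_isGloballyMinimal
  haveI iNZT : NeZero (((⟨0, -1, 0, -961, -11167⟩ : WeierstrassCurve ℤ).map (Int.castRingHom ℚ)).conductorNorm ℤ) :=
    neZero_conductorNorm_of_isElliptic _
  haveI iP := Fact.mk (by norm_num : Nat.Prime 7)
  haveI : Fact (Nat.Prime 659) := ⟨by norm_num⟩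
  haveI : NeZero (659 : ℕ) := ⟨by norm_num⟩
  have hsur : ((⟨1, 1, 1, -15, 16⟩ : WeierstrassCurve ℤ).map (Int.castRingHom ℚ)).HasSurjectiveModNGaloisRep ((7 : ℕ) : ℤ) := by
    simpa using hasSurjectiveModNGaloisRep_7
  have htower : ∀ k : ℕ, ((⟨1, 1, 1, -15, 16⟩ : WeierstrassCurve ℤ).map (Int.castRingHom ℚ)).HasSurjectiveModNGaloisRep ((7 : ℕ) ^ k : ℕ) :=
    serre_hasSurjectiveModNGaloisRep_pow_holds _ 7 (by norm_num) hsur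
  have hsp := spadeOne_of_five_le 7 (by norm_num)
  have hS2 : ¬ Squarefree (((⟨1, 1, 1, -15, 16⟩ : WeierstrassCurve ℤ).map (Int.castRingHom ℚ)).conductorNorm ℤ) →
      (∃ (ℓ : ℕ) (_ : Fact ℓ.Prime), ((⟨1, 1, 1, -15, 16⟩ : WeierstrassCurve ℤ).map (Int.castRingHom ℚ)).HasMultiplicativeReductionAtPrime ℓ ∧
          ¬ 7 ∣ padicValInt ℓ ((⟨1, 1, 1, -15, 16⟩ : WeierstrassCurve ℤ).map (Int.castRingHom ℚ)).minimalDiscriminantInt) ∧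
        ∃ (ℓ₁ ℓ₂ : ℕ) (_ : Fact ℓ₁.Prime) (_ : Fact ℓ₂.Prime), ℓ₁ ≠ ℓ₂ ∧
          ((⟨1, 1, 1, -15, 16⟩ : WeierstrassCurve ℤ).map (Int.castRingHom ℚ)).HasMultiplicativeReductionAtPrime ℓ₁ ∧
          ((⟨1, 1, 1, -15, 16⟩ : WeierstrassCurve ℤ).map (Int.castRingHom ℚ)).HasMultiplicativeReductionAtPrime ℓ₂ :=
    fun hns ↦ absurd ((((⟨1, 1, 1, -15, 16⟩ : WeierstrassCurve ℤ).map (Int.castRingHom ℚ))).isSemistable_iff_squarefree_conductorNorm.mp hsp.2) hns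
  have hH := satisfiesHeegnerHypothesis_conductorNorm_of_intModel intModel K hK.1 hD heegner_neg8
  have hD3 : NumberField.discr K ≠ -3 := by rw [hD]; norm_num
  have hD4 : NumberField.discr K ≠ -4 := by rw [hD]; norm_num
  have hpD : ¬ (((7 : ℕ) : ℤ) ∣ NumberField.discr K) := by rw [hD]; decide
  have hC : (⟨1, (-3 : ℚ), (0 : ℚ), (0 : ℚ)⟩ : WeierstrassCurve.VariableChange ℚ) •
      ((⟨0, -1, 0, -961, -11167⟩ : WeierstrassCurve ℤ).map (Int.castRingHom ℚ)) =
      ((⟨1, 1, 1, -15, 16⟩ : WeierstrassCurve ℤ).map (Int.castRingHom ℚ)).quadraticTwist ((NumberField.discr K : ℤ) : ℚ) := by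
    rw [hD]; push_cast; exact minTwist8_smul_eq
  have hr2 := Summit.BirchSwinnertonDyer.BirchSwinnertonDyer.Rank2Observatory.C563a1.mordellWeilRank_eq_two
  have hiff := kolyvaginPrime_iff_twistKuriharaBit_7_neg8 h372 h84 hKim hSak1 hSak2 hnf hMaz K hK hD hδE
  constructor
  · intro hbit D hc hu
    have hT := (natCard_selmerGroup_quadraticTwist_le_iff_kuriharaBit hKim hSak1 hSak2 hnf hMaz _ 7 (by norm_num) goodOrdinary_7.1
      goodOrdinary_7.2 hsur (NumberField.discr_ne_zero K) hpD _ _ hC minTwist8_nonAnomalous_7 (minTwist8_kodairaNeron_of_five_le 7 (by norm_num)) 1).mpr (hiff.mp hbit)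
    rw [pow_one] at hT
    exact twistKuriharaClaim_prime_of_natCard_selmerGroup_le hSak3 _ 7 (by norm_num) goodOrdinary_7.1 goodOrdinary_7.2 hsur
      (NumberField.discr_ne_zero K) hpD _ _ hC minTwist8_nonAnomalous_7 (minTwist8_kodairaNeron_of_five_le 7 (by norm_num)) hT 659
      minTwist8_isCyclicKolyvaginLevel_7_659 _ minTwist8_localNondivisible_659 D hc hu
  · intro hunit
    refine hiff.mpr fun D hc hu ↦ ?_
    obtain ⟨ψ, hψ, hne⟩ := hunit D hc hu
    refine ⟨659, inferInstance, minTwist8_isCyclicKolyvaginLevel_7_659, ?_, ψ, hψ, hne⟩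
    rw [Nat.Prime.primeFactors (by norm_num), Finset.card_singleton]

/-- **AGREEMENT of the two decisive primes of row `563a1` @ `(7, -8)`: `δ̃_281(T₀)` is a unit ⟺ `δ̃_659(T₀)` is a unit**
(for every admissible datum; each side is ⟺ the row's bit — `twistKuriharaBit_iff_unit_281` of `…KuriharaDecisive563a1` and
`twistKuriharaBit_iff_unit_659` above). A fleet computation returning a unit at one and a zero at the other contradicts the print
facts named (or the engine). CONDITIONAL on the named facts and the E-side claim; per curve; BSD is not proved by it.
[cite: Sakamoto2022pSelmer, Lemma 4.4, Lemma 4.6 (1)] [cite: Kim2022StructureSelmer, Thm. 1.11] -/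
theorem unit_281_iff_unit_659
    (h372 : GrossLMS1991.prop37_2_frobeniusCongruence)
    (h84 : Literature.NumberTheory.EllipticCurves.WZhang2014_lemma84_exists_minimal_kolyvaginClass_one_selmerCard)
    (hKim : Kim2022_card_selmerGroup_le_pow_of_kuriharaNumber_ne_zero)
    (hSak1 : Sakamoto2022_card_selmerGroup_eq_pow_of_isDeltaMinimal)
    (hSak2 : Sakamoto2022_exists_cyclicLevel_kuriharaNumber_ne_zero)
    (hSak3 : Literature.NumberTheory.EllipticCurves.Sakamoto2022_kuriharaNumber_prime_ne_zero_of_localNondivisible)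
    (hnf : exists_isNewformOf) (hMaz : mazur_not_dvd_maninConstant_of_odd)
    (K : Type) [Field K] [NumberField K] (hK : IsImaginaryQuadratic K) (hD : NumberField.discr K = -8)
    (hδE : haveI := isElliptic_c563a1; haveI := isGloballyMinimal_c563a1;
      haveI : NeZero (((⟨1, 1, 1, -15, 16⟩ : WeierstrassCurve ℤ).map (Int.castRingHom ℚ)).conductorNorm ℤ) := neZero_conductorNorm_of_isElliptic _;
      haveI := Fact.mk (by norm_num : Nat.Prime 7);
      ∀ (D : ModularParametrizationData ((⟨1, 1, 1, -15, 16⟩ : WeierstrassCurve ℤ).map (Int.castRingHom ℚ)) (((⟨1, 1, 1, -15, 16⟩ : WeierstrassCurve ℤ).map (Int.castRingHom ℚ)).conductorNorm ℤ)), ¬ ((7 : ℕ) : ℤ) ∣ D.maninConstant →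
        (∃ u : ℚ, ‖(u : ℚ_[7])‖ = 1 ∧ ((⟨1, 1, 1, -15, 16⟩ : WeierstrassCurve ℤ).map (Int.castRingHom ℚ)).realPeriodRat = u * plusPeriod D.f) →
        ∃ ψ : (ℓ : ℕ) → (ZMod ℓ)ˣ →* Multiplicative (ZMod 7),
          (∀ ℓ ∈ (8149 : ℕ).primeFactors, Function.Surjective (ψ ℓ)) ∧ kuriharaNumber D.f 7 8149 ψ ≠ 0) :
    haveI := isElliptic_c563a1; haveI := isGloballyMinimal_c563a1;
    haveI : NeZero (((⟨1, 1, 1, -15, 16⟩ : WeierstrassCurve ℤ).map (Int.castRingHom ℚ)).conductorNorm ℤ) := neZero_conductorNorm_of_isElliptic _;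
    haveI := minTwist8_isElliptic; haveI := minTwist8_isGloballyMinimal;
    haveI : NeZero (((⟨0, -1, 0, -961, -11167⟩ : WeierstrassCurve ℤ).map (Int.castRingHom ℚ)).conductorNorm ℤ) := neZero_conductorNorm_of_isElliptic _;
    haveI := Fact.mk (by norm_num : Nat.Prime 7);
    (∀ (D : ModularParametrizationData ((⟨0, -1, 0, -961, -11167⟩ : WeierstrassCurve ℤ).map (Int.castRingHom ℚ))
          (((⟨0, -1, 0, -961, -11167⟩ : WeierstrassCurve ℤ).map (Int.castRingHom ℚ)).conductorNorm ℤ)),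
        ¬ ((7 : ℕ) : ℤ) ∣ D.maninConstant →
        (∃ u : ℚ, ‖(u : ℚ_[7])‖ = 1 ∧
          ((⟨0, -1, 0, -961, -11167⟩ : WeierstrassCurve ℤ).map (Int.castRingHom ℚ)).realPeriodRat = u * plusPeriod D.f) →
        ∃ ψ : (q : ℕ) → (ZMod q)ˣ →* Multiplicative (ZMod 7),
          (∀ q ∈ (281 : ℕ).primeFactors, Function.Surjective (ψ q)) ∧ kuriharaNumber D.f 7 281 ψ ≠ 0) ↔
    (∀ (D : ModularParametrizationData ((⟨0, -1, 0, -961, -11167⟩ : WeierstrassCurve ℤ).map (Int.castRingHom ℚ))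
          (((⟨0, -1, 0, -961, -11167⟩ : WeierstrassCurve ℤ).map (Int.castRingHom ℚ)).conductorNorm ℤ)),
        ¬ ((7 : ℕ) : ℤ) ∣ D.maninConstant →
        (∃ u : ℚ, ‖(u : ℚ_[7])‖ = 1 ∧
          ((⟨0, -1, 0, -961, -11167⟩ : WeierstrassCurve ℤ).map (Int.castRingHom ℚ)).realPeriodRat = u * plusPeriod D.f) →
        ∃ ψ : (q : ℕ) → (ZMod q)ˣ →* Multiplicative (ZMod 7),
          (∀ q ∈ (659 : ℕ).primeFactors, Function.Surjective (ψ q)) ∧ kuriharaNumber D.f 7 659 ψ ≠ 0) :=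
  (twistKuriharaBit_iff_unit_281 h372 h84 hKim hSak1 hSak2 hSak3 hnf hMaz K hK hD hδE).symm.trans
    (twistKuriharaBit_iff_unit_659 h372 h84 hKim hSak1 hSak2 hSak3 hnf hMaz K hK hD hδE)

end C563a1

end Summit.BirchSwinnertonDyer.BirchSwinnertonDyer.Theorems.KolyvaginDepthDoor

end
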